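import Summits.KontsevichZagierPeriods.KontsevichZagierPeriods.Theorems.UnfoldedStokesStokesGenerationStubFibrewiseStokesCalibration
import Summits.KontsevichZagierPeriods.KontsevichZagierPeriods.Theorems.UnfoldedStokesStokesGenerationLineReduction
import Summits.KontsevichZagierPeriods.KontsevichZagierPeriods.Theorems.UnfoldedStokesStokesGenerationFibrewiseRungScaling
import Literature.NumberTheory.Transcendental.KZProductIdeal
import Literature.NumberTheory.Transcendental.KZLogCalculusProofs
import Literature.NumberTheory.Transcendental.KZCubicalCalculus

/-!
# `CubeKernelStep` (stmt-KontsevichZagierPeriods-17854), line `Sketch`: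
# stub `stub_derivativeSubLayer`

The RUNG stub `stub_derivativeSubLayer` (K2's derivative sub-layer) of the skeleton
`Cruxes/CubeKernelStep/Lines/Sketch.lean` of the crux `CubeKernelStep` (route UnfoldedStokes):
under the lower layers `K(≤d)`, if the integrand of a closed `(d+1)`-cube representation `t` is,
at every point of the cube with `z 0 ∈ (0,1)`, the `z 0`-derivative of a function `G` which is
`ℚ`-semialgebraic and continuous on the closed cube, and `t` has value `0`, then
`[t] ∈ KZ.relations`.

Proof. Bring the parameter coordinate `0` last by the transposition `e = (0 last)`: reindexing is
a change-of-variables move (`KZ.of_sub_of_reindex_mem_relations`, rule (2)), and the fibrewise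
data transport to `G' = G ∘ (· ∘ e)`, `t₁ = t.reindex e`
(`Function.update_apply_equiv_apply`).
For the last coordinate (`of_mem_relations_of_hasDerivAt_last`): let
`r' = [[0,1]^d, y ↦ G (y, 1) − G (y, 0)]` (continuous and `ℚ`-semialgebraic,
`face_semialgebraic_continuousOn`) and `t''` its lift to the `(d+1)`-cube (`exists_liftCube_succ`,
one Newton–Leibniz move). The representation `q = [[0,1]^{d+1}, t − t'']` is the fibrewise
Stokes element of `(G, t)` along the last coordinate, a relation by the landed
`stub_fibrewiseStokesCalibration` (no kinks: `K = ∅`); `[t] − [q] − [t'']` is an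
integrand-additivity move (rule (1b)). Hence `[t] ≡ [r']`, so `r'` has value `t.value = 0` by
soundness (`KZ.relations_le_ker_eval_holds`), and `K(≤d)` at `M = d` gives `[r'] ∈ relations`.
[Kontsevich–Zagier 2001, §1.2 rules (1)–(3)]
-/

noncomputable section

set_option linter.dupNamespace false

namespace Summit.KontsevichZagierPeriods.KontsevichZagierPeriods.Cruxes.CubeKernelStep.Layers

open MeasureTheory Set
open Literature.ModelTheory.ExponentialFields (IsSemialgebraic isSemialgebraic_empty)
open Literature.NumberTheory.Transcendental
open Literature.NumberTheory.Transcendental.KZ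
open Summit.KontsevichZagierPeriods.KontsevichZagierPeriods.Cruxes.StokesGeneration.FibrewiseStokes
  (stub_fibrewiseStokesCalibration setOf_comp_perm_mem_cubePi update_mem_cubePi)
open Summit.KontsevichZagierPeriods.KontsevichZagierPeriods.StokesGenerationLine
  (exists_liftCube_succ face_semialgebraic_continuousOn snoc_init_eq_update isSemialgebraic_cubePi)

/-! ## Small facts -/

/-- Soundness transfer: if `[t] − [r]` is a relation and `t` has value `0`, so has `r`.
[folklore] -/
theorem value_eq_zero_of_sub_mem_relations {n m : ℕ} {t : IntegralRep n} {r : IntegralRep m}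
    (h : of t - of r ∈ relations) (ht : t.value = 0) : r.value = 0 := by
  have h0 := relations_le_ker_eval_holds h
  rw [AddMonoidHom.mem_ker, map_sub, eval_of, eval_of, ht, zero_sub, neg_eq_zero] at h0
  exact h0

/-! ## The last coordinate -/

/-- **Derivative sub-layer along the last coordinate.** Under `K(≤d)`, a closed `(d+1)`-cube
representation `t` of value `0` whose integrand is, at the points of the cube with
`x last ∈ (0,1)`, the `x last`-derivative of a `ℚ`-semialgebraic continuous `G` on the closed
cube, is a relation: `[t] = [q] + ([t] − [q] − [t'']) − ([r'] − [t'']) + [r']` with `q` the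
fibrewise Stokes element of `(G, t)` (landed `stub_fibrewiseStokesCalibration`), `r'` the
continuous `d`-cube representation `y ↦ G (y,1) − G (y,0)` of value `0` (killed by `K(≤d)`)
and `t''` its Newton–Leibniz lift. [cite: KontsevichZagier2001, §1.2 rule (3)] -/
theorem of_mem_relations_of_hasDerivAt_last (d : ℕ)
    (hK : ∀ (M : ℕ), M ≤ d → ∀ (a : IntegralRep M),
        a.domain = Set.pi Set.univ (fun _ : Fin M => Set.Icc (0:ℝ) 1) →
        ContinuousOn a.integrand a.domain → a.value = 0 → of a ∈ relations)
    (t : IntegralRep (d + 1)) (G : (Fin (d + 1) → ℝ) → ℝ)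
    (htd : t.domain = Set.pi Set.univ (fun _ : Fin (d + 1) => Set.Icc (0:ℝ) 1))
    (hG : IsSemialgebraicFunOn ℚ (Set.pi Set.univ (fun _ : Fin (d + 1) => Set.Icc (0:ℝ) 1)) G)
    (hGc : ContinuousOn G (Set.pi Set.univ (fun _ : Fin (d + 1) => Set.Icc (0:ℝ) 1)))
    (hder : ∀ x ∈ Set.pi Set.univ (fun _ : Fin (d + 1) => Set.Icc (0:ℝ) 1),
      x (Fin.last d) ∈ Set.Ioo (0:ℝ) 1 →
        HasDerivAt (fun s : ℝ => G (Function.update x (Fin.last d) s)) (t.integrand x)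
          (x (Fin.last d)))
    (hval : t.value = 0) : of t ∈ relations := by
  classical
  have hCQ : cube (d + 1) ⊆ Set.pi Set.univ (fun _ : Fin (d + 1) => Set.Icc (0:ℝ) 1) :=
    (cube_eq_pi (d + 1)).le
  have hQc : IsCompact (Set.pi Set.univ (fun _ : Fin (d + 1) => Set.Icc (0:ℝ) 1)) :=
    isCompact_univ_pi fun _ => isCompact_Icc
  -- the base representation `r' = [[0,1]^d, G(·,1) − G(·,0)]` and its lift `t''`
  obtain ⟨hs1, hc1⟩ := face_semialgebraic_continuousOn hCQ hG hGc 1 ⟨1, Rat.cast_one⟩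
    ⟨zero_le_one, le_rfl⟩
  obtain ⟨hs0, hc0⟩ := face_semialgebraic_continuousOn hCQ hG hGc 0 ⟨0, Rat.cast_zero⟩
    ⟨le_rfl, zero_le_one⟩
  let r' : IntegralRep d := ⟨cube d, fun y => G (Fin.snoc y 1) - G (Fin.snoc y 0),
    isSemialgebraic_cube, hs1.fun_sub hs0, (hc1.sub hc0).integrableOn_compact isCompact_cube⟩
  have hr'd : r'.domain = Set.pi Set.univ (fun _ : Fin d => Set.Icc (0:ℝ) 1) := cube_eq_pi d
  obtain ⟨t'', ht''d, ht''i, hlift⟩ := exists_liftCube_succ d r' hr'd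
  have ht''i' : ∀ x ∈ Set.pi Set.univ (fun _ : Fin (d + 1) => Set.Icc (0:ℝ) 1),
      t''.integrand x =
        G (Function.update x (Fin.last d) 1) - G (Function.update x (Fin.last d) 0) := by
    intro x hx
    rw [ht''i x hx]
    show G (Fin.snoc (Fin.init x) 1) - G (Fin.snoc (Fin.init x) 0) = _
    rw [snoc_init_eq_update, snoc_init_eq_update]
  -- the fibrewise Stokes element `q = [[0,1]^{d+1}, t − t'']`
  have htI : IntegrableOn t.integrand
      (Set.pi Set.univ (fun _ : Fin (d + 1) => Set.Icc (0:ℝ) 1)) := by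
    rw [← htd]; exact t.integrableOn
  have ht''I : IntegrableOn t''.integrand
      (Set.pi Set.univ (fun _ : Fin (d + 1) => Set.Icc (0:ℝ) 1)) := by
    rw [← ht''d]; exact t''.integrableOn
  have htS : IsSemialgebraicFunOn ℚ (Set.pi Set.univ (fun _ : Fin (d + 1) => Set.Icc (0:ℝ) 1))
      t.integrand := by
    rw [← htd]; exact t.isSemialgebraicFunOn_integrand
  have ht''S : IsSemialgebraicFunOn ℚ (Set.pi Set.univ (fun _ : Fin (d + 1) => Set.Icc (0:ℝ) 1))
      t''.integrand := by
    rw [← ht''d]; exact t''.isSemialgebraicFunOn_integrand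
  let q : IntegralRep (d + 1) := ⟨Set.pi Set.univ (fun _ : Fin (d + 1) => Set.Icc (0:ℝ) 1),
    fun x => t.integrand x - t''.integrand x, isSemialgebraic_cubePi (d + 1), htS.fun_sub ht''S,
    htI.sub ht''I⟩
  have hq : of q ∈ relations := by
    refine stub_fibrewiseStokesCalibration (d + 1) (Fin.last d) G t.integrand ∅ hG htS
      isSemialgebraic_empty ?_ ?_ ?_ ?_ q rfl ?_
    · obtain ⟨B, hB⟩ := hQc.exists_bound_of_continuousOn hGc
      exact ⟨B, fun x hx => by simpa only [Real.norm_eq_abs] using hB x hx⟩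
    · intro x _
      simp
    · intro x hx
      have hγ : Continuous fun s : ℝ => Function.update x (Fin.last d) s :=
        continuous_const.update (Fin.last d) continuous_id
      exact hGc.comp hγ.continuousOn fun s hs => update_mem_cubePi hx (Fin.last d) hs
    · intro x hx _ hxl
      exact hder x hx hxl
    · intro x hx
      show t.integrand x - t''.integrand x = _
      rw [ht''i' x hx]
  -- integrand additivity `[t] − [q] − [t'']` (rule (1b))
  have hadd : of t - of q - of t'' ∈ relations := by
    refine integrandAddRel_subset_relations ⟨d + 1, t, q, t'', htd.symm, ht''d.trans htd.symm,
      fun x _ => ?_, rfl⟩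
    show t.integrand x = (t.integrand x - t''.integrand x) + t''.integrand x
    ring
  -- `[t] ≡ [r']`, so `r'` has value `0` and `K(≤d)` applies
  have htr' : of t - of r' ∈ relations := by
    have e : of t - of r' = (of t - of q - of t'') + of q - (of r' - of t'') := by abel
    rw [e]
    exact relations.sub_mem (relations.add_mem hadd hq) hlift
  have hr' : of r' ∈ relations :=
    hK d le_rfl r' hr'd (hc1.sub hc0) (value_eq_zero_of_sub_mem_relations htr' hval)
  have e : of t = (of t - of r') + of r' := by abel
  rw [e]
  exact relations.add_mem htr' hr'

/-! ## The registered stub -/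

/-- RUNG (K2's derivative sub-layer) of crux `CubeKernelStep`, line `Sketch`: **parameter
derivatives are relations.** Under `K(≤d)` (`d ≥ 1`), if `G` is `ℚ`-semialgebraic and
continuous on the closed `(d+1)`-cube and the continuous integrand of `t` is the
`z 0`-derivative of `G` at every point of the cube with `z 0 ∈ (0,1)`, and `t` has value `0`,
then `t` is a relation:
transport the parameter coordinate `0` to the last place by the transposition `(0 last)`
(`KZ.of_sub_of_reindex_mem_relations`, rule (2)) and apply
`of_mem_relations_of_hasDerivAt_last`. [cite: KontsevichZagier2001, §1.2 rule (3)] -/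
theorem stub_derivativeSubLayer :
    ∀ d : ℕ, 1 ≤ d →
      (∀ (M : ℕ), M ≤ d → ∀ (a : IntegralRep M),
        a.domain = Set.pi Set.univ (fun _ : Fin M => Set.Icc (0:ℝ) 1) →
        ContinuousOn a.integrand a.domain → a.value = 0 → of a ∈ relations) →
      ∀ (t : IntegralRep (d + 1)) (G : (Fin (d + 1) → ℝ) → ℝ),
        t.domain = Set.pi Set.univ (fun _ : Fin (d + 1) => Set.Icc (0:ℝ) 1) →
        IsSemialgebraicFunOn ℚ (Set.pi Set.univ (fun _ : Fin (d + 1) => Set.Icc (0:ℝ) 1)) G →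
        ContinuousOn G (Set.pi Set.univ (fun _ : Fin (d + 1) => Set.Icc (0:ℝ) 1)) →
        ContinuousOn t.integrand t.domain →
        (∀ x ∈ Set.pi Set.univ (fun _ : Fin (d + 1) => Set.Icc (0:ℝ) 1), x 0 ∈ Set.Ioo (0:ℝ) 1 →
          HasDerivAt (fun s : ℝ => G (Function.update x 0 s)) (t.integrand x) (x 0)) →
        t.value = 0 → of t ∈ relations := by
  intro d _ hK t G htd hG hGc _ hder hval
  classical
  -- the transposition `(0 last)` and the transported data
  obtain ⟨e, he0⟩ : ∃ e : Equiv.Perm (Fin (d + 1)), e 0 = Fin.last d :=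
    ⟨Equiv.swap 0 (Fin.last d), Equiv.swap_apply_left _ _⟩
  have hesymm : e.symm (Fin.last d) = 0 := by rw [← he0, Equiv.symm_apply_apply]
  have hQe : {w : Fin (d + 1) → ℝ | (fun j => w (e j)) ∈
      Set.pi Set.univ (fun _ : Fin (d + 1) => Set.Icc (0:ℝ) 1)} =
        Set.pi Set.univ (fun _ : Fin (d + 1) => Set.Icc (0:ℝ) 1) :=
    setOf_comp_perm_mem_cubePi e
  have hmemQ : ∀ w ∈ Set.pi Set.univ (fun _ : Fin (d + 1) => Set.Icc (0:ℝ) 1),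
      (fun j => w (e j)) ∈ Set.pi Set.univ (fun _ : Fin (d + 1) => Set.Icc (0:ℝ) 1) :=
    fun w hw j _ => hw (e j) (mem_univ _)
  have hupd : ∀ (w : Fin (d + 1) → ℝ) (c : ℝ),
      (fun j => Function.update w (Fin.last d) c (e j)) =
        Function.update (fun j => w (e j)) 0 c := by
    intro w c
    funext j
    rw [Function.update_apply_equiv_apply, hesymm]
    rfl
  have hG' : IsSemialgebraicFunOn ℚ (Set.pi Set.univ (fun _ : Fin (d + 1) => Set.Icc (0:ℝ) 1))
      (fun w => G (fun j => w (e j))) := by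
    simpa only [hQe] using hG.comp_equiv e
  have hLc : Continuous fun (w : Fin (d + 1) → ℝ) (j : Fin (d + 1)) => w (e j) :=
    continuous_pi fun j => continuous_apply (e j)
  have hG'c : ContinuousOn (fun w => G (fun j => w (e j)))
      (Set.pi Set.univ (fun _ : Fin (d + 1) => Set.Icc (0:ℝ) 1)) :=
    hGc.comp hLc.continuousOn hmemQ
  have ht₁d : (t.reindex e).domain =
      Set.pi Set.univ (fun _ : Fin (d + 1) => Set.Icc (0:ℝ) 1) := by
    rw [IntegralRep.reindex_domain, htd]
    exact hQe
  have hder' : ∀ w ∈ Set.pi Set.univ (fun _ : Fin (d + 1) => Set.Icc (0:ℝ) 1),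
      w (Fin.last d) ∈ Set.Ioo (0:ℝ) 1 →
        HasDerivAt (fun s : ℝ => G (fun j => Function.update w (Fin.last d) s (e j)))
          ((t.reindex e).integrand w) (w (Fin.last d)) := by
    intro w hw hwl
    have hwl' : w (e 0) ∈ Set.Ioo (0:ℝ) 1 := by rw [he0]; exact hwl
    have h := hder _ (hmemQ w hw) hwl'
    rw [he0] at h
    simpa only [IntegralRep.reindex_integrand, hupd] using h
  have hval₁ : (t.reindex e).value = 0 :=
    value_eq_zero_of_sub_mem_relations (of_sub_of_reindex_mem_relations t e) hval
  have hcore := of_mem_relations_of_hasDerivAt_last d hK (t.reindex e)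
    (fun w => G (fun j => w (e j))) ht₁d hG' hG'c hder' hval₁
  have key : of t = (of t - of (t.reindex e)) + of (t.reindex e) := by abel
  rw [key]
  exact relations.add_mem (of_sub_of_reindex_mem_relations t e) hcore

end Summit.KontsevichZagierPeriods.KontsevichZagierPeriods.Cruxes.CubeKernelStep.Layers

end
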